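import Literature.NumberTheory.EllipticCurves.X049EtaDescent
import Literature.NumberTheory.EllipticCurves.HeegnerPointsClassesProofs
import Literature.NumberTheory.EllipticCurves.ModularParametrizationDegree
import Literature.NumberTheory.QuadraticFields.KroneckerSplitting
import Literature.NumberTheory.QuadraticFields.HeegnerCondition
import Literature.NumberTheory.QuadraticFields.FundamentalDiscriminant
import Mathlib.NumberTheory.NumberField.Norm
import HarnessLib

/-!
# (F-norm′) PROVED from (F-η) + (F-D′): the `2`-isogeny descent class of a conductor-one Heegner point of `X₀(49)` is prime to one
# prime over `7` (Ligozat 1975 + Deuring, Lang *Elliptic Functions* Ch. 12 §2 Thm 5)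

Cell `bsd-goldfeld`, seat `bsd-goldfeld-s1p-c301` (prover, gen 17); memo `run/shared/lean/pub/bsd-goldfeld/F3-ETA-DESCENT.md` §3–§4.
Theorems only: the named fact `x049_heegner_norm_x_sub_two_not_mem'` (the binder `hEta₁` of THEOREM A‴/B‴ on the family F3, `q ≡ 3 (mod 8)`, in its
repaired typing `IsImaginaryQuadratic K`) is DERIVED from the two classical facts `x049_x_sub_two_eq_etaQuotient` (F-η: `x − 2 = η(τ)/η(49τ)` on
`X₀(49)`) and `deuring_etaQuotient49_heegner_generates_conjPrime'` (F-D′: `(η(τ₁)/η(49τ₁)) = 𝔮̄·𝓞_{K[1]}`), so that the cell's `η`-currency is TWO named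
facts, not three. THE PROOF (memo §3–§4): for `d : KolyvaginHeegnerData D β ι 1` the point `y(1) ∈ X₀(49)(K[1])` maps to `φ_D(τ₁)`,
`τ₁ = heegnerTau Q₁`, `Q₁ = ((β² − d_K)/4, β, 1)` the Heegner form of conductor `1`; a Heegner datum `H` with `H.β = β` exists
(`nonempty_heegnerDatum_holds`) and `Q₁ ∼ Q' ∈ H.reps` under `Γ₀(49)` (`HeegnerDatum.exists_isGamma0Equiv`), so `φ_D(τ₁) = φ_D(τ_{Q'})`
(`Γ₀(49)`-invariance, `φ_gamma0_smul_holds'`) `= (2 + u, ∗)` by (F-η) with `u = η(τ_{Q'})/η(49τ_{Q'})` an algebraic integer of `K[1]` generating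
`𝔮̄'𝓞_{K[1]}`, `𝔮̄' ∋ 7` a prime of `𝓞_K` (F-D′). Hence `x(y(1)) − 2 = u`, `b := N_{K[1]/K}(u) ∈ 𝓞_K`. From `196 ∣ β² − d_K` and `7² ∤ d_K`:
`(d_K/7) = +1`, so `7𝓞_K = 𝔮𝔮̄'` with TWO primes, each unramified (`Quadratic.ncard_primesOver_eq_two_iff_jacobiSym`,
`SplitPrime.ramificationIdx_eq_one_of_ncard_primesOver`, `Ideal.ramificationIdx'_ne_one_iff`): take `𝔮 ≠ 𝔮̄'`; then `7 ∈ 𝔮`, `7 ∉ 𝔮²`, and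
`b ∉ 𝔮`: otherwise, for a prime `𝔓 ∣ 𝔮` of `𝓞_{K[1]}`, `b = ∏_σ σ(u) ∈ 𝔓` (`Algebra.norm_eq_prod_automorphisms`, `K[1]/K` Galois) puts some `σ(u)` in
`𝔓`, i.e. `u ∈ σ⁻¹𝔓`, whence `𝔮̄'𝓞_{K[1]} = (u) ⊆ σ⁻¹𝔓` and `𝔮̄' ⊆ σ⁻¹𝔓 ∩ 𝓞_K = 𝔮`, contradicting `𝔮 ≠ 𝔮̄'`.
HONEST FRAMING: conditional on the two named print facts (F-η), (F-D′) by name and nothing else; says nothing about BSD.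
References: [Ligozat1975] Prop. 3.1.1; [Lang1987] Ch. 12 §2 Thm 4–5; [Gross1984] §§4–5; [Cox2013] §5.B Prop. 5.16, Thm. 7.7.
-/

noncomputable section

open scoped UpperHalfPlane

open WeierstrassCurve IsDedekindDomain NumberField Ideal
open Literature.NumberTheory.EllipticCurves Literature.NumberTheory.EllipticCurves.ModularForms

namespace Literature.NumberTheory.EllipticCurves

variable {K : Type} [Field K] [NumberField K]

/-- From `196 ∣ β² − d_K` for an imaginary quadratic `K`: `7 ∤ β` (else `49 ∣ d_K`, but `d_K` is fundamental) and `(d_K/7) = +1`,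
so `7` has exactly two primes in `𝓞_K`. [cite: Cox2013, §5.B Prop. 5.16] -/
private theorem ncard_primesOver_seven_eq_two (hK : IsImaginaryQuadratic K) {β : ℤ}
    (hβ : (4 * 49 : ℤ) ∣ β ^ 2 - NumberField.discr K) :
    ((Ideal.span {((7 : ℕ) : ℤ)}).primesOver (𝓞 K)).ncard = 2 := by
  have h7β : ¬ (7 : ℤ) ∣ β := by
    intro h7
    have h49 : (49 : ℤ) ∣ β ^ 2 := by rw [show (49 : ℤ) = 7 ^ 2 by norm_num]; exact pow_dvd_pow_of_dvd h7 2
    have hdK : ((7 : ℕ) ^ 2 : ℤ) ∣ NumberField.discr K := by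
      have : (49 : ℤ) ∣ β ^ 2 - NumberField.discr K := (show (49 : ℤ) ∣ 4 * 49 from ⟨4, by norm_num⟩).trans hβ
      have h' := (dvd_sub_right h49).mp this
      simpa using h'
    exact Literature.NumberTheory.QuadraticFields.Quadratic.not_sq_dvd_discr_of_prime_ne_two hK.1 (by norm_num) (by norm_num) hdK
  rw [Literature.NumberTheory.QuadraticFields.Quadratic.ncard_primesOver_eq_two_iff_jacobiSym hK.1 (by norm_num) (by norm_num)]
  have hmod : NumberField.discr K % ((7 : ℕ) : ℤ) = β ^ 2 % ((7 : ℕ) : ℤ) := by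
    have : (7 : ℤ) ∣ β ^ 2 - NumberField.discr K := (show (7 : ℤ) ∣ 4 * 49 from ⟨28, by norm_num⟩).trans hβ
    push_cast
    omega
  have hcop : IsCoprime β 7 :=
    ((Prime.coprime_iff_not_dvd (Int.prime_iff_natAbs_prime.mpr (by norm_num))).mpr h7β).symm
  rw [jacobiSym.mod_left (NumberField.discr K), hmod, ← jacobiSym.mod_left (β ^ 2)]
  exact jacobiSym.sq_one' (Int.isCoprime_iff_gcd_eq_one.mp hcop)

/-- Given one prime `v' ∋ 7` of `𝓞_K` (`K` imaginary quadratic, `196 ∣ β² − d_K`): the OTHER prime `𝔮 ∋ 7`, unramified (`7 ∉ 𝔮²`).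
[cite: Cox2013, §5.B Prop. 5.16] -/
private theorem exists_other_prime_seven (hK : IsImaginaryQuadratic K) {β : ℤ}
    (hβ : (4 * 49 : ℤ) ∣ β ^ 2 - NumberField.discr K) (v' : Ideal (𝓞 K)) (hv' : v'.IsPrime) (h7 : (7 : 𝓞 K) ∈ v') :
    ∃ 𝔮 : Ideal (𝓞 K), 𝔮.IsPrime ∧ 𝔮 ≠ v' ∧ (7 : 𝓞 K) ∈ 𝔮 ∧ (7 : 𝓞 K) ∉ 𝔮 ^ 2 := by
  have h2 := ncard_primesOver_seven_eq_two hK hβ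
  set q : Ideal ℤ := Ideal.span {((7 : ℕ) : ℤ)} with hq
  have hq0 : q ≠ ⊥ := by simp [hq]
  have hqmax : q.IsMaximal :=
    ((Ideal.span_singleton_prime (by norm_num)).mpr (Int.prime_iff_natAbs_prime.mpr (by norm_num))).isMaximal hq0
  -- membership in `primesOver q` ⟺ prime containing `7`
  have hover : ∀ P : Ideal (𝓞 K), P.IsPrime → ((P ∈ q.primesOver (𝓞 K)) ↔ (7 : 𝓞 K) ∈ P) := by
    intro P hP
    constructor
    · rintro ⟨-, ⟨hPq⟩⟩
      have : ((7 : ℕ) : ℤ) ∈ P.under ℤ := hPq ▸ Ideal.mem_span_singleton_self _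
      simpa [Ideal.under_def, Ideal.mem_comap] using this
    · intro h7P
      refine ⟨hP, ⟨hqmax.eq_of_le (Ideal.comap_ne_top _ hP.ne_top) ?_⟩⟩
      rw [hq, Ideal.span_singleton_le_iff_mem, Ideal.mem_comap]
      simpa using h7P
  obtain ⟨P₁, P₂, hne, heq⟩ := Set.ncard_eq_two.mp h2
  have hv'mem : v' ∈ q.primesOver (𝓞 K) := (hover v' hv').mpr h7
  have hP₁ : P₁ ∈ q.primesOver (𝓞 K) := by rw [heq]; exact Set.mem_insert _ _
  have hP₂ : P₂ ∈ q.primesOver (𝓞 K) := by rw [heq]; exact Set.mem_insert_of_mem _ rfl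
  -- the other prime
  obtain ⟨𝔮, h𝔮mem, h𝔮ne⟩ : ∃ 𝔮, 𝔮 ∈ q.primesOver (𝓞 K) ∧ 𝔮 ≠ v' := by
    rw [heq] at hv'mem
    rcases hv'mem with rfl | rfl
    · exact ⟨P₂, hP₂, hne.symm⟩
    · exact ⟨P₁, hP₁, hne⟩
  have h𝔮P : 𝔮.IsPrime := h𝔮mem.1
  have h7𝔮 : (7 : 𝓞 K) ∈ 𝔮 := (hover 𝔮 h𝔮P).mp h𝔮mem
  refine ⟨𝔮, h𝔮P, h𝔮ne, h7𝔮, fun h7sq ↦ ?_⟩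
  -- unramified: `e(𝔮 | 7) = 1`
  have hram := (Literature.NumberTheory.QuadraticFields.SplitPrime.ramificationIdx_eq_one_of_ncard_primesOver (K := K)
    (by norm_num : Nat.Prime 7) (by rw [h2, hK.1]) h𝔮mem).1
  have hmap : Ideal.map (algebraMap ℤ (𝓞 K)) q = Ideal.span {(7 : 𝓞 K)} := by
    rw [hq, Ideal.map_span, Set.image_singleton]; simp
  have hle : Ideal.map (algebraMap ℤ (𝓞 K)) q ≤ 𝔮 := by
    rw [hmap, Ideal.span_singleton_le_iff_mem]; exact h7𝔮
  exact ((Ideal.ramificationIdx'_ne_one_iff hle).mpr (by rw [hmap, Ideal.span_singleton_le_iff_mem]; exact h7sq)) hram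

/-- The Galois step: if `(u) = v'·𝓞_{K[1]}` for a prime `v'` of `𝓞_K` then `N_{K[1]/K}(u) ∉ 𝔮` for every other maximal `𝔮 ≠ v'`
(`N(u) = ∏_σ σu`; a prime `𝔓 ∣ 𝔮` containing it contains some `σu`, so `v'𝓞 = (u) ⊆ σ⁻¹𝔓` and `v' ⊆ 𝔮`). [cite: Cox2013, Thm. 7.7] -/
private theorem norm_not_mem_of_span_eq_map (hK : IsImaginaryQuadratic K) (ι : K →+* ℂ)
    (u : 𝓞 (ringClassField K ι 1)) (v' 𝔮 : Ideal (𝓞 K)) (hv' : v'.IsMaximal) (h𝔮 : 𝔮.IsMaximal) (hne : 𝔮 ≠ v')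
    (hspan : Ideal.span {u} = v'.map (algebraMap (𝓞 K) (𝓞 (ringClassField K ι 1)))) :
    RingOfIntegers.norm K u ∉ 𝔮 := by
  obtain ⟨hfd, hgal⟩ := finiteDimensional_and_isGalois_ringClassField hK ι one_ne_zero
  intro hb
  obtain ⟨𝔓, h𝔓max, h𝔓⟩ := Ideal.exists_ideal_over_maximal_of_isIntegral (S := 𝓞 (ringClassField K ι 1)) 𝔮
    (by rw [RingOfIntegers.ker_algebraMap_eq_bot]; exact bot_le)
  have hb' : algebraMap (𝓞 K) (𝓞 (ringClassField K ι 1)) (RingOfIntegers.norm K u) ∈ 𝔓 := by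
    rw [← Ideal.mem_comap, h𝔓]; exact hb
  have hprod : algebraMap (𝓞 K) (𝓞 (ringClassField K ι 1)) (RingOfIntegers.norm K u) =
      ∏ σ : (ringClassField K ι 1) ≃ₐ[K] (ringClassField K ι 1), RingOfIntegers.mapAlgEquiv σ u := by
    apply RingOfIntegers.coe_injective
    change ((algebraMap (𝓞 K) (𝓞 (ringClassField K ι 1)) (RingOfIntegers.norm K u) : ringClassField K ι 1)) = _
    rw [RingOfIntegers.coe_algebraMap_norm, Algebra.norm_eq_prod_automorphisms]
    rw [map_prod]
    rfl
  rw [hprod] at hb'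
  haveI := h𝔓max.isPrime
  obtain ⟨σ, -, hσ⟩ := Ideal.IsPrime.prod_mem_iff.mp hb'
  have hle : v' ≤ 𝔮 := by
    intro z hz
    have h1 : algebraMap (𝓞 K) (𝓞 (ringClassField K ι 1)) z ∈ Ideal.span {u} := by
      rw [hspan]; exact Ideal.mem_map_of_mem _ hz
    obtain ⟨c, hc⟩ := Ideal.mem_span_singleton'.mp h1
    have h2 : RingOfIntegers.mapAlgEquiv σ (algebraMap (𝓞 K) (𝓞 (ringClassField K ι 1)) z) ∈ 𝔓 := by
      rw [← hc, map_mul]; exact 𝔓.mul_mem_left _ hσ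
    rw [AlgEquiv.commutes] at h2
    rw [← h𝔓, Ideal.mem_comap]; exact h2
  exact hne (hv'.eq_of_le h𝔮.ne_top hle).symm

/-- **(F-norm′) from (F-η) + (F-D′).** For `K` imaginary quadratic, an optimal datum `D` of `cm7` (`|D.c| = 1`), `196 ∣ β² − d_K` and
Kolyvagin–Heegner data `d` of conductor `1`: `y(1) = (x, y)` is affine and `N_{K[1]/K}(x − 2) = b ∈ 𝓞_K` lies outside an unramified prime
`𝔮 ∋ 7` of `𝓞_K` — derived, not posited: `x − 2 = η(τ_{Q'})/η(49τ_{Q'})` by (F-η) and `Γ₀(49)`-invariance of `φ`, `(x − 2) = 𝔮̄'𝓞_{K[1]}` by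
(F-D′), `7 = 𝔮𝔮̄'` split and unramified since `d_K ≡ β² (mod 49)` is fundamental, and `b = ∏σ(x − 2) ∉ 𝔮`. Memo F3-ETA-DESCENT §3–§4.
[cite: Ligozat1975, Prop. 3.1.1 and table N = 49 (p. 45)] [cite: Lang1987, Ch. 12 §2 Thm. 4 and Thm. 5] [cite: Gross1984, §§4–5] -/
theorem x049_heegner_norm_x_sub_two_not_mem'_of_etaQuotient (hEta : x049_x_sub_two_eq_etaQuotient)
    (hD : deuring_etaQuotient49_heegner_generates_conjPrime') : x049_heegner_norm_x_sub_two_not_mem' := by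
  intro K _ _ ι hK D hc β d
  -- a Heegner datum with the orientation `β`, and a representative `Q' ∼ Q₁` of the conductor-one form
  obtain ⟨H, hHβ⟩ := nonempty_heegnerDatum_holds 49 K hK d.dvd_sq_sub
  have hQ₁ := heegnerFormOfConductor_mem_heegnerForms (N := 49) hK.discr_neg d.dvd_sq_sub one_ne_zero
  simp only [Nat.cast_one, one_pow, one_mul] at hQ₁
  obtain ⟨Q', hQ', γ, hγ⟩ := H.exists_isGamma0Equiv _ hQ₁.1 (by rw [hHβ]; exact hQ₁.2)
  -- (F-D′) at `Q'`, (F-η) at `τ_{Q'}`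
  obtain ⟨u, v', hu, h7', hspan⟩ := hD K ι hK H Q' hQ'
  obtain ⟨yτ, hns, hφ⟩ := hEta D hc (heegnerTau Q')
  -- `y(1) ↦ φ(τ₁) = φ(τ_{Q'})`
  have hmap : Affine.Point.map (ringClassField K ι 1).subtype.toRatAlgHom d.y = D.φ (heegnerTau Q') := by
    rw [d.map_y, ← hγ, D.φ_gamma0_smul_holds']; rfl
  rw [hφ] at hmap
  rcases hy : d.y with _ | @⟨x, y, hxy⟩
  · rw [hy] at hmap
    have h0 : Affine.Point.map (ringClassField K ι 1).subtype.toRatAlgHom (0 : (cm7.baseChange (ringClassField K ι 1)).toAffine.Point) =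
        _ := hmap
    rw [Affine.Point.map_zero] at h0
    cases h0
  · rw [hy, Affine.Point.map_some] at hmap
    have hx : ((x : ringClassField K ι 1) : ℂ) =
        2 + ModularForm.eta (heegnerTau Q') / ModularForm.eta (UpperHalfPlane.ofComplex (49 * ((heegnerTau Q' : ℍ) : ℂ))) :=
      ((Affine.Point.some.injEq _ _ _ _ _ _).mp hmap).1
    have hxu : x - 2 = (u : ringClassField K ι 1) :=
      Subtype.ext (show (x : ℂ) - 2 = ((u : ringClassField K ι 1) : ℂ) by rw [hx, hu]; ring)
    refine ⟨x, y, hxy, rfl, RingOfIntegers.norm K u, ?_⟩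
    -- the other prime over `7`
    obtain ⟨𝔮, h𝔮P, h𝔮ne, h7𝔮, h7sq⟩ := exists_other_prime_seven hK d.dvd_sq_sub v'.asIdeal v'.isPrime h7'
    have h𝔮0 : 𝔮 ≠ ⊥ := fun h ↦ by
      rw [h, Ideal.mem_bot] at h7𝔮
      exact absurd h7𝔮 (by norm_num)
    refine ⟨⟨𝔮, h𝔮P, h𝔮0⟩, ?_, h7𝔮, h7sq, ?_⟩
    · rw [hxu]; exact RingOfIntegers.coe_norm K u
    · exact norm_not_mem_of_span_eq_map hK ι u v'.asIdeal 𝔮 (v'.isPrime.isMaximal v'.ne_bot) (h𝔮P.isMaximal h𝔮0) h𝔮ne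
        hspan

/-! ## After the in-place repair (2026-08-28) the unprimed facts carry the hypothesis too: the same theorem for the unprimed names -/

/-- Since the in-place repair of `X049EtaDescent.lean` the unprimed (F-D) is literally the primed (F-D′). [cite: Lang1987, Ch. 12 §2 Thm. 4 and Thm. 5] -/
theorem deuring_etaQuotient49_heegner_generates_conjPrime_iff_primed :
    deuring_etaQuotient49_heegner_generates_conjPrime ↔ deuring_etaQuotient49_heegner_generates_conjPrime' := Iff.rfl

/-- Since the in-place repair of `X049EtaDescent.lean` the unprimed (F-norm) is literally the primed (F-norm′).
[cite: Ligozat1975, Prop. 3.1.1 and table N = 49 (p. 45)] [cite: Lang1987, Ch. 12 §2 Thm. 4 and Thm. 5] -/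
theorem x049_heegner_norm_x_sub_two_not_mem_iff_primed :
    x049_heegner_norm_x_sub_two_not_mem ↔ x049_heegner_norm_x_sub_two_not_mem' := Iff.rfl

/-- **(F-norm) from (F-η) + (F-D), unprimed names** — the binder `hEta : x049_heegner_norm_x_sub_two_not_mem` of THEOREM A‴/B‴
(`…TwinHalfTraceThreeModEightOfPrint`, `…TwinBirchTheoremBTriplePrime`) is DISCHARGED by the two classical facts
`x049_x_sub_two_eq_etaQuotient` (Ligozat) and `deuring_etaQuotient49_heegner_generates_conjPrime` (Deuring): consumers may replace `hEta₁` by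
`x049_heegner_norm_x_sub_two_not_mem_of_etaQuotient hEta hD`. [cite: Ligozat1975, Prop. 3.1.1 and table N = 49 (p. 45)]
[cite: Lang1987, Ch. 12 §2 Thm. 4 and Thm. 5] [cite: Gross1984, §§4–5] -/
theorem x049_heegner_norm_x_sub_two_not_mem_of_etaQuotient (hEta : x049_x_sub_two_eq_etaQuotient)
    (hD : deuring_etaQuotient49_heegner_generates_conjPrime) : x049_heegner_norm_x_sub_two_not_mem :=
  x049_heegner_norm_x_sub_two_not_mem'_of_etaQuotient hEta hD

end Literature.NumberTheory.EllipticCurves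

end
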